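import Summits.NavierStokesRegularity.NavierStokesRegularity.Theorems.RungBlowupCofinal.Negative.SectoralWaveCasimir
import Summits.NavierStokesRegularity.FluidComputer.AngularGalerkinLadderLaplacian
import Summits.NavierStokesRegularity.FluidComputer.AngularGalerkinLadderRadialCutoff
import Summits.NavierStokesRegularity.FluidComputer.AngularGalerkinLadderStructure
import Summits.NavierStokesRegularity.FluidComputer.AngularGalerkinLadderDivergence
import Literature.Analysis.FluidPDE.AncientSimilarityVorticity
import Literature.Analysis.FluidPDE.VorticityCalculus
import HarnessLib

/-!
# The curl and the radial derivative keep the angular band; the curl of a co-band field is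
# co-band; hence a band-limited field that is a gradient up to a co-band defect is CURL-FREE
# (route `AngularGalerkinLadder`, crux K1 `RungBlowupCofinal`; kinematic helper, theorems only)

Cell `ns-blowup`, seat `ns-blowup-circuit` (g12, AGL Lean seat). Helper file for
`stmt-NavierStokesRegularity-19959` (K1 of route №8) serving the line
`Cruxes/RungBlowupCofinal/Lines/qlwave.lean` (mean–wave rung profiles), support target (S4) of its
card «PURE-WAVE EXCLUSION» — part 1 of the chain (this file: the projection-free kinematics that
remove the pressure and the defect from the LINEAR precessing profile equation
`−ΔW + ½W + ½DW·y + αJ₃W + ∇Q = E`).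
LABEL: KERNEL kinematics. Nothing here asserts a Theses declaration; no definition, no named fact.
WHAT THIS IS NOT: not Navier–Stokes evidence — vector-calculus identities for smooth fields on
`EuclideanSpace ℝ (Fin 3)` in the vocabulary of `FluidComputer/AngularGalerkinLadder.lean`; no rung dynamics, no profile.

## Content

* §1 **`curl_angGen`**: `curl (J_a u) = J_a (curl u)` for smooth `u` — the curl is
  `SO(3)`-equivariant; at the level of the generators `J_a u = e_a × u − ((e_a × x)·∇)u` this is the
  matrix identity `e × curlM + curl(M ∘ [e]_×) = (tr M) e − M e` (`cross_curlCLM_add_curlCLM_comp`)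
  together with the symmetry of `D²u`. Hence **`casimir_curl`**, **`bandDefect_curl`**,
  **`isBandLimited_curl`** (band-limited in, band-limited out).
* §2 **`angGen_radialDeriv`**: the Leray transport term `y ↦ DW(y)·y` (generator of dilations)
  commutes with every `J_a` (dilations commute with rotations); hence **`casimir_radialDeriv`**,
  **`bandDefect_radialDeriv`**, **`isBandLimited_radialDeriv`**, and **`isBandLimited_profileOp`**:
  the linear precessing Leray profile operator `W ↦ −νΔW + ½W + ½DW·y + αJ₃W` keeps the band
  (with the tree's `IsBandLimited.laplacian` and K5-75 `isBandLimited_angGen`).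
* §3 **`isCobandLimited_curl`**: the curl of a `C¹` co-band-limited field is co-band-limited
  (integration by parts `∫⟪curl F, ψ⟫ = ∫⟪F, curl ψ⟫`, tree
  `integral_inner_curl_eq_integral_inner_curl`, and §1 for the test field).
* §4 **`curl_eq_zero_of_add_gradient_eq_coband`**: if `G` is band-limited of degree `≤ L`, `Q` is
  smooth and `G + ∇Q = E` pointwise with `E` co-band-limited of degree `≤ L`, then `curl G = 0`:
  `curl G = curl E` (the gradient is curl-free) is band-limited (§1) AND co-band-limited (§3), so it
  vanishes by the tree's `IsBandLimited.eq_zero_of_isCobandLimited`. Specialised to the wave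
  equation of a mean–wave profile with `V = 0` (`profileResidual_curl_eq_zero`): the linear residual
  `−ΔW + ½W + ½DW·y + αJ₃W` of a band-limited `W` is CURL-FREE — the pressure and the defect are
  gone, projection-free.

[cite: BullardGellman1954] (toroidal/poloidal vector spherical harmonics are `curl`-stable
isotype by isotype; here in the tree's Casimir-cut typing); [cite: MajdaBertozziCUP2002, §1.1
(vector identities)].
-/

noncomputable section

namespace Summit.NavierStokesRegularity.AngularGalerkinLadderBandLimitedCurl

open Set Function MeasureTheory
open scoped ContDiff RealInnerProductSpace Laplacian
open Literature.Analysis.FluidPDE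
open Summit.NavierStokesRegularity.FluidComputer
open Summit.NavierStokesRegularity.FluidComputer.AngularLadder

variable {u : EuclideanSpace ℝ (Fin 3) → EuclideanSpace ℝ (Fin 3)} {L : ℕ}
  {x : EuclideanSpace ℝ (Fin 3)}

/-! ## §1 The curl commutes with the rotation generators -/

/-- The matrix identity behind `curl ∘ J_a = J_a ∘ curl`:
`e × curl(M) + curl(M ∘ [e]_×) = (tr M) e − M e` for a vector `e` and a linear map `M` (trace in
the standard frame). [folklore] -/
theorem cross_curlCLM_add_curlCLM_comp (e : EuclideanSpace ℝ (Fin 3))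
    (M : EuclideanSpace ℝ (Fin 3) →L[ℝ] EuclideanSpace ℝ (Fin 3)) :
    cross e (curlCLM M) + curlCLM (M.comp (crossCLM e)) =
      (∑ i, M (EuclideanSpace.single i 1) i) • e - M e := by
  -- expand every `M v` along the standard frame
  have hv : ∀ v : EuclideanSpace ℝ (Fin 3), v = ∑ j, v j • EuclideanSpace.single j (1 : ℝ) :=
      fun v => by
    conv_lhs => rw [← (EuclideanSpace.basisFun (Fin 3) ℝ).sum_repr v]
    simp
  have hMv : ∀ v : EuclideanSpace ℝ (Fin 3), M v = ∑ j, v j • M (EuclideanSpace.single j 1) :=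
      fun v => by
    conv_lhs => rw [hv v]
    simp [map_sum, map_smul]
  have hMe := hMv e
  have hMc : ∀ j : Fin 3, (M.comp (crossCLM e)) (EuclideanSpace.single j 1) =
      ∑ k, (cross e (EuclideanSpace.single j 1)) k • M (EuclideanSpace.single k 1) :=
      fun j => by
    rw [ContinuousLinearMap.comp_apply, crossCLM_apply]
    exact hMv _
  have hL : curlCLM (M.comp (crossCLM e)) = WithLp.toLp 2
      ![(M.comp (crossCLM e)) (EuclideanSpace.single 1 1) 2 -
          (M.comp (crossCLM e)) (EuclideanSpace.single 2 1) 1,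
        (M.comp (crossCLM e)) (EuclideanSpace.single 2 1) 0 -
          (M.comp (crossCLM e)) (EuclideanSpace.single 0 1) 2,
        (M.comp (crossCLM e)) (EuclideanSpace.single 0 1) 1 -
          (M.comp (crossCLM e)) (EuclideanSpace.single 1 1) 0] := rfl
  rw [hL, hMe]
  simp only [hMc]
  ext i
  fin_cases i <;>
    simp [curlCLM, curlLM, cross, cross_apply, Fin.sum_univ_three] <;> ring

/-- The derivative field of a smooth map is differentiable. [folklore] -/
private theorem differentiableAt_fderiv_of_smooth {F : Type*} [NormedAddCommGroup F]
    [NormedSpace ℝ F] {f : EuclideanSpace ℝ (Fin 3) → F} (hf : ContDiff ℝ ∞ f)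
    (x : EuclideanSpace ℝ (Fin 3)) :
    DifferentiableAt ℝ (fderiv ℝ f) x :=
  (contDiff_infty_iff_fderiv.1 hf).2.differentiable (by simp) x

/-- A smooth field is `C²`. [folklore] -/
private theorem contDiff_two_of_smooth {F : Type*} [NormedAddCommGroup F] [NormedSpace ℝ F]
    {f : EuclideanSpace ℝ (Fin 3) → F} (hf : ContDiff ℝ ∞ f) : ContDiff ℝ 2 f :=
  contDiff_infty.1 hf 2

/-- The curl of a smooth field is smooth. [folklore] -/
private theorem contDiff_curl_of_smooth (hu : ContDiff ℝ ∞ u) : ContDiff ℝ ∞ (curl u) := by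
  rw [curl_eq_curlCLM_comp]
  exact curlCLM.contDiff.comp ((contDiff_infty_iff_fderiv.1 hu).2)

/-- **The curl commutes with every rotation generator**: `curl (J_a u) = J_a (curl u)` for smooth
`u` (`curl` is `SO(3)`-equivariant). [cite: MajdaBertozziCUP2002, §1.1 (vector identities)] -/
theorem curl_angGen (hu : ContDiff ℝ ∞ u) (a : Fin 3) :
    curl (angGen a u) = angGen a (curl u) := by
  have hu2 : ContDiff ℝ 2 u := contDiff_two_of_smooth hu
  funext x
  -- left-hand side: `curlCLM (D(J_a u)(x))`
  rw [curl_eq_curlCLM, fderiv_angGen hu a x, fderiv_fderiv_flip_apply_eq hu x]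
  -- right-hand side: `e_a × curl u x − D(curl u)(x)(e_a × x)`
  rw [angGen_eq a (curl u)]
  simp only
  rw [fderiv_curl hu2 x, ContinuousLinearMap.comp_apply, curl_eq_curlCLM, map_sub, map_add]
  have key := cross_curlCLM_add_curlCLM_comp (axis a) (fderiv ℝ u x)
  rw [curlCLM_crossCLM_comp]
  -- `curlCLM ([e]× ∘ M) = (tr M) e − M e = e × curl M + curlCLM (M ∘ [e]×)`
  rw [← key]
  simp only [crossCLM_apply]
  abel

/-- **The curl commutes with the Casimir**: `curl (𝒞 u) = 𝒞 (curl u)` for smooth `u`.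
[folklore] -/
theorem casimir_curl (hu : ContDiff ℝ ∞ u) : curl (casimir u) = casimir (curl u) := by
  have hJ : ∀ a : Fin 3, ContDiff ℝ ∞ (angGen a u) := fun a => contDiff_angGen hu a
  have hJJ : ∀ a : Fin 3, ContDiff ℝ ∞ (angGen a (angGen a u)) := fun a =>
    contDiff_angGen (hJ a) a
  have hd : ∀ a : Fin 3, Differentiable ℝ (angGen a (angGen a u)) := fun a =>
    (hJJ a).differentiable (by simp)
  have h2 : ∀ a : Fin 3, curl (angGen a (angGen a u)) = angGen a (angGen a (curl u)) :=
      fun a => by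
    rw [curl_angGen (hJ a) a, curl_angGen hu a]
  funext x
  have e1 : casimir u = fun y => -(angGen 0 (angGen 0 u) y + angGen 1 (angGen 1 u) y +
      angGen 2 (angGen 2 u) y) := by
    funext y; simp only [casimir, Fin.sum_univ_three]
  have h01 : DifferentiableAt ℝ (fun y => angGen 0 (angGen 0 u) y + angGen 1 (angGen 1 u) y) x :=
    (hd 0 x).fun_add (hd 1 x)
  rw [e1, curl_neg, curl_add h01 (hd 2 x), curl_add (hd 0 x) (hd 1 x)]
  simp only [casimir, Fin.sum_univ_three, h2]

/-- **The curl commutes with every band defect** `∏_{j ≤ L}(𝒞 − j(j+1))`. [folklore] -/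
theorem bandDefect_curl (hu : ContDiff ℝ ∞ u) (L : ℕ) :
    curl (bandDefect L u) = bandDefect L (curl u) := by
  induction L with
  | zero => exact casimir_curl hu
  | succ L ih =>
      have hB : ContDiff ℝ ∞ (bandDefect L u) := contDiff_bandDefect hu L
      have hC : Differentiable ℝ (casimir (bandDefect L u)) :=
        (contDiff_casimir hB).differentiable (by simp)
      have hBd : Differentiable ℝ (bandDefect L u) := hB.differentiable (by simp)
      funext x
      change curl (fun y => casimir (bandDefect L u) y -
          (((L : ℝ) + 1) * ((L : ℝ) + 2)) • bandDefect L u y) x =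
        casimir (bandDefect L (curl u)) x -
          (((L : ℝ) + 1) * ((L : ℝ) + 2)) • bandDefect L (curl u) x
      have hS : DifferentiableAt ℝ
          (fun y => (((L : ℝ) + 1) * ((L : ℝ) + 2)) • bandDefect L u y) x :=
        (hBd x).fun_const_smul _
      rw [curl_sub (hC x) hS, curl_const_smul (hBd x), ← ih, casimir_curl hB]

/-- **Band-limited in, band-limited out**: the curl (vorticity) of a field band-limited of degree
`≤ L` is band-limited of degree `≤ L` — each vector-spherical-harmonic isotype is `curl`-stable.
[cite: BullardGellman1954] -/
theorem isBandLimited_curl (hu : IsBandLimited L u) : IsBandLimited L (curl u) := by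
  refine ⟨contDiff_curl_of_smooth hu.1, fun x => ?_⟩
  have h0 : bandDefect L u = fun _ => (0 : EuclideanSpace ℝ (Fin 3)) := funext hu.2
  rw [← bandDefect_curl hu.1 L, h0]
  exact curl_fun_zero x

/-! ## §2 The radial derivative (generator of dilations) keeps the band -/

/-- The derivative of the Leray transport term: `D(y ↦ Du(y)·y)(x) w = Du(x) w + D²u(x)(w)(x)`.
[folklore] -/
theorem hasFDerivAt_radialDeriv (hu : ContDiff ℝ ∞ u) (x : EuclideanSpace ℝ (Fin 3)) :
    HasFDerivAt (fun y => fderiv ℝ u y y)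
      ((fderiv ℝ u x).comp (ContinuousLinearMap.id ℝ (EuclideanSpace ℝ (Fin 3))) +
        (fderiv ℝ (fderiv ℝ u) x).flip x) x :=
  (differentiableAt_fderiv_of_smooth hu x).hasFDerivAt.clm_apply (hasFDerivAt_id x)

/-- The Leray transport term of a smooth field is smooth. [folklore] -/
theorem contDiff_radialDeriv (hu : ContDiff ℝ ∞ u) :
    ContDiff ℝ ∞ fun y => fderiv ℝ u y y :=
  ((contDiff_infty_iff_fderiv.1 hu).2).clm_apply contDiff_id

/-- **The radial derivative commutes with every rotation generator**:
`J_a (y ↦ Du(y)·y) = (y ↦ D(J_a u)(y)·y)` for smooth `u` (dilations commute with rotations; at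
the generator level the identity is the symmetry of `D²u` plus `[e_a]_× y` being linear in `y`).
[folklore] -/
theorem angGen_radialDeriv (hu : ContDiff ℝ ∞ u) (a : Fin 3) :
    angGen a (fun y => fderiv ℝ u y y) = fun y => fderiv ℝ (angGen a u) y y := by
  funext x
  rw [angGen_eq a (fun y => fderiv ℝ u y y)]
  simp only
  rw [(hasFDerivAt_radialDeriv hu x).fderiv, fderiv_angGen hu a x, fderiv_fderiv_flip_apply_eq hu x]
  simp only [_root_.add_apply, _root_.sub_apply,
    ContinuousLinearMap.comp_apply, ContinuousLinearMap.id_apply, ContinuousLinearMap.flip_apply]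

/-- **The radial derivative commutes with the Casimir**. [folklore] -/
theorem casimir_radialDeriv (hu : ContDiff ℝ ∞ u) :
    casimir (fun y => fderiv ℝ u y y) = fun y => fderiv ℝ (casimir u) y y := by
  have hJ : ∀ a : Fin 3, ContDiff ℝ ∞ (angGen a u) := fun a => contDiff_angGen hu a
  have hJJ : ∀ a : Fin 3, ContDiff ℝ ∞ (angGen a (angGen a u)) := fun a =>
    contDiff_angGen (hJ a) a
  have hd : ∀ a : Fin 3, Differentiable ℝ (angGen a (angGen a u)) := fun a =>
    (hJJ a).differentiable (by simp)
  have h2 : ∀ a : Fin 3, angGen a (angGen a fun y => fderiv ℝ u y y) =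
      fun y => fderiv ℝ (angGen a (angGen a u)) y y := fun a => by
    rw [angGen_radialDeriv hu a, angGen_radialDeriv (hJ a) a]
  funext x
  have e1 : casimir u = fun y => -(angGen 0 (angGen 0 u) y + angGen 1 (angGen 1 u) y +
      angGen 2 (angGen 2 u) y) := by
    funext y; simp only [casimir, Fin.sum_univ_three]
  have h01 : DifferentiableAt ℝ (fun y => angGen 0 (angGen 0 u) y + angGen 1 (angGen 1 u) y) x :=
    (hd 0 x).fun_add (hd 1 x)
  rw [e1]
  simp only [casimir, Fin.sum_univ_three, h2]
  rw [fderiv_fun_neg, fderiv_fun_add h01 (hd 2 x), fderiv_fun_add (hd 0 x) (hd 1 x)]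
  simp only [_root_.neg_apply, _root_.add_apply]

/-- **The radial derivative commutes with every band defect**. [folklore] -/
theorem bandDefect_radialDeriv (hu : ContDiff ℝ ∞ u) (L : ℕ) :
    bandDefect L (fun y => fderiv ℝ u y y) = fun y => fderiv ℝ (bandDefect L u) y y := by
  induction L with
  | zero => exact casimir_radialDeriv hu
  | succ L ih =>
      have hB : ContDiff ℝ ∞ (bandDefect L u) := contDiff_bandDefect hu L
      have hC : Differentiable ℝ (casimir (bandDefect L u)) :=
        (contDiff_casimir hB).differentiable (by simp)
      have hBd : Differentiable ℝ (bandDefect L u) := hB.differentiable (by simp)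
      funext x
      change casimir (bandDefect L fun y => fderiv ℝ u y y) x -
          (((L : ℝ) + 1) * ((L : ℝ) + 2)) • bandDefect L (fun y => fderiv ℝ u y y) x =
        fderiv ℝ (fun y => casimir (bandDefect L u) y -
          (((L : ℝ) + 1) * ((L : ℝ) + 2)) • bandDefect L u y) x x
      have hS : DifferentiableAt ℝ
          (fun y => (((L : ℝ) + 1) * ((L : ℝ) + 2)) • bandDefect L u y) x :=
        (hBd x).fun_const_smul _
      rw [ih, casimir_radialDeriv hB, fderiv_fun_sub (hC x) hS, fderiv_fun_const_smul (hBd x)]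
      simp only [_root_.sub_apply, _root_.smul_apply]

/-- **Band-limited in, band-limited out**: the Leray transport term `y ↦ DW(y)·y` of a field
band-limited of degree `≤ L` is band-limited of degree `≤ L`. [cite: BullardGellman1954] -/
theorem isBandLimited_radialDeriv (hu : IsBandLimited L u) :
    IsBandLimited L fun y => fderiv ℝ u y y := by
  refine ⟨contDiff_radialDeriv hu.1, fun x => ?_⟩
  have h0 : bandDefect L u = fun _ => (0 : EuclideanSpace ℝ (Fin 3)) := funext hu.2
  rw [bandDefect_radialDeriv hu.1 L, h0]
  simp

/-- **The linear precessing Leray profile operator keeps the band**: for `W` band-limited of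
degree `≤ L`, the field `y ↦ −νΔW(y) + ½W(y) + ½DW(y)·y + α·(J₃W)(y)` (`J₃ = angGen 2`) is
band-limited of degree `≤ L` — every letter of the LINEAR part of the mean–wave equations
commutes with the Casimir cut. [cite: BullardGellman1954] -/
theorem isBandLimited_profileOp (hu : IsBandLimited L u) (ν α : ℝ) :
    IsBandLimited L fun y => -(ν • (Δ u) y) + (1 / 2 : ℝ) • u y + (1 / 2 : ℝ) • fderiv ℝ u y y +
      α • angGen 2 u y := by
  have h1 : IsBandLimited L (Δ u) := hu.laplacian
  have h2 : IsBandLimited L (fun y => fderiv ℝ u y y) := isBandLimited_radialDeriv hu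
  have h3 : IsBandLimited L (angGen 2 u) :=
    AngularGalerkinLadderSectoralWave.isBandLimited_angGen hu 2
  have h := (((h1.smul ν).neg).add (hu.smul (1 / 2 : ℝ))).add (h2.smul (1 / 2 : ℝ)) |>.add
    (h3.smul α)
  have e : (fun y => -(ν • (Δ u) y) + (1 / 2 : ℝ) • u y + (1 / 2 : ℝ) • fderiv ℝ u y y +
      α • angGen 2 u y) = -(ν • Δ u) + (1 / 2 : ℝ) • u +
        (1 / 2 : ℝ) • (fun y => fderiv ℝ u y y) + α • angGen 2 u := by
    funext y; simp
  rw [e]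
  exact h

/-! ## §3 The curl of a co-band field is co-band -/

/-- **The curl of a `C¹` co-band-limited field is co-band-limited** (same degree): for a
compactly supported band-limited test field `ψ`, `∫⟪curl F, ψ⟫ = ∫⟪F, curl ψ⟫ = 0` because
`curl ψ` is again band-limited with compact support (§1). [folklore] -/
theorem isCobandLimited_curl {F : EuclideanSpace ℝ (Fin 3) → EuclideanSpace ℝ (Fin 3)}
    (hF : IsCobandLimited L F) (hF1 : ContDiff ℝ 1 F) :
    IsCobandLimited L (curl F) := by
  intro ψ hψ hψc
  have hψ1 : ContDiff ℝ 1 ψ := contDiff_infty.1 hψ.1 1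
  rw [integral_inner_curl_eq_integral_inner_curl hF1 hψ1 hψc]
  exact hF (curl ψ) (isBandLimited_curl hψ) (hasCompactSupport_curl hψc)

/-! ## §4 A band-limited field that is a gradient up to a co-band defect is curl-free -/

/-- **Band-limited + gradient = co-band ⟹ curl-free.** If `G` is band-limited of degree `≤ L`,
`Q` is smooth and `G + ∇Q = E` pointwise with `E` co-band-limited of degree `≤ L`, then
`curl G = 0`: `curl G = curl E` (a gradient is curl-free) is band-limited (§1) and co-band-limited
(§3), hence zero (`IsBandLimited.eq_zero_of_isCobandLimited`). No continuity, growth or decay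
hypothesis on `E` or `Q` is needed — the identity makes `E` smooth. [folklore] -/
theorem curl_eq_zero_of_add_gradient_eq_coband
    {G E : EuclideanSpace ℝ (Fin 3) → EuclideanSpace ℝ (Fin 3)} {Q : EuclideanSpace ℝ (Fin 3) → ℝ}
    (hG : IsBandLimited L G) (hQ : ContDiff ℝ ∞ Q) (hE : IsCobandLimited L E)
    (h : ∀ y, G y + gradient Q y = E y) : curl G = 0 := by
  -- `E` is the smooth field `G + ∇Q`
  have hEe : E = fun y => G y + gradient Q y := funext fun y => (h y).symm
  have hQ2 : ContDiff ℝ 2 Q := contDiff_infty.1 hQ 2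
  have hgrad : ContDiff ℝ ∞ (gradient Q) := by
    have e : gradient Q = fun y =>
        (InnerProductSpace.toDual ℝ (EuclideanSpace ℝ (Fin 3))).symm (fderiv ℝ Q y) := rfl
    rw [e]
    exact (InnerProductSpace.toDual ℝ (EuclideanSpace ℝ (Fin 3))).symm.contDiff.comp
      ((contDiff_infty_iff_fderiv.1 hQ).2)
  have hEs : ContDiff ℝ ∞ E := by rw [hEe]; exact hG.1.add hgrad
  have hE1 : ContDiff ℝ 1 E := contDiff_infty.1 hEs 1
  -- `curl E = curl G`
  have hGd : Differentiable ℝ G := hG.1.differentiable (by simp)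
  have hgd : Differentiable ℝ (gradient Q) := hgrad.differentiable (by simp)
  have hcurl : Literature.Analysis.FluidPDE.curl E = curl G := by
    funext y
    rw [hEe, curl_add (hGd y) (hgd y), curl_gradient_eq_zero_holds Q hQ2 y, add_zero]
  -- band-limited and co-band-limited
  have hc : IsCobandLimited L (curl G) := hcurl ▸ isCobandLimited_curl hE hE1
  exact (isBandLimited_curl hG).eq_zero_of_isCobandLimited hc

/-- **The linear residual of a pure wave is curl-free.** If `W` is band-limited of degree `≤ L`
and solves the LINEAR precessing profile equation
`−νΔW + ½W + ½DW·y + α·J₃W + ∇Q = E` with a smooth pressure `Q` and a co-band-limited defect `E`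
(this is the wave equation of a mean–wave profile of the line `qlwave` with zonal part `V = 0`,
`ν = 1`), then `curl (−νΔW + ½W + ½DW·y + α·J₃W) = 0`: the pressure and the defect drop out,
projection-free. [folklore] -/
theorem profileResidual_curl_eq_zero
    {W E : EuclideanSpace ℝ (Fin 3) → EuclideanSpace ℝ (Fin 3)} {Q : EuclideanSpace ℝ (Fin 3) → ℝ}
    {ν α : ℝ}
    (hW : IsBandLimited L W) (hQ : ContDiff ℝ ∞ Q) (hE : IsCobandLimited L E)
    (h : ∀ y, -(ν • (Δ W) y) + (1 / 2 : ℝ) • W y + (1 / 2 : ℝ) • fderiv ℝ W y y +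
      α • angGen 2 W y + gradient Q y = E y) :
    curl (fun y => -(ν • (Δ W) y) + (1 / 2 : ℝ) • W y + (1 / 2 : ℝ) • fderiv ℝ W y y +
      α • angGen 2 W y) = 0 :=
  curl_eq_zero_of_add_gradient_eq_coband (isBandLimited_profileOp hW ν α) hQ hE h

end Summit.NavierStokesRegularity.AngularGalerkinLadderBandLimitedCurl

end
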